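import Mathlib.LinearAlgebra.Eigenspace.Pi
import Literature.NumberTheory.EllipticCurves.PrimeLevelEigenpacketNewformProofs
import Literature.NumberTheory.EllipticCurves.NewformEigencharacter
import HarnessLib

/-!
# The newform behind an eigenform of the `T_q` (`q ∤ Np`) **and `U_p`** on `S_k(Γ₁(Np))`,
# `p ∤ N` prime, for an ARBITRARY nebentypus: `a_p` of the newform from the `U_p`-eigenvalue
# (proofs only)

Topic `Literature/NumberTheory/EllipticCurves`; namespace
`Literature.NumberTheory.EllipticCurves.ModularForms`.  THEOREMS ONLY (no definition, no named
fact; D-0026).  A companion of `exists_isNewform1_of_eigenpacket_prime_level`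
(`PrimeLevelEigenpacketNewformProofs`), which treats the same question under the hypothesis that
the nebentypus is PRIMITIVE modulo `N`; here that hypothesis is removed (the nebentypus of a
weight-one newform, or of its `p`-stabilisation, is rarely primitive), at the price of allowing the
newform to have any level `L₀ ∣ Np`.

**Statement** (`exists_isNewform1_of_eigenpacket_of_heckeT_prime`).  Let `p ∤ N` be a prime and
`g ∈ S_k(Γ₁(Np))`, `g ≠ 0`, lie in the `χ`-eigenspace of the diamond operators
(`χ` any Dirichlet character modulo `Np`) and satisfy `T_q g = a_q g` for every prime `q ∤ Np` and
`U_p g = μ g`.  Then there are `L₀ ∣ Np` and a newform `g₀ ∈ S_k(Γ₁(L₀))` with `a_q(g₀) = a_q`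
for all primes `q ∤ Np`, whose nebentypus induces `χ`, and

* either `p ∣ L₀` and `a_p(g₀) = μ`,
* or `p ∤ L₀` and `μ² - a_p(g₀) μ + ε_{g₀}(p) p^{k-1} = 0` (`μ` is a root of the Hecke polynomial
  of `g₀` at `p`).

In both cases `a_p(g₀)` is read off the `U_p`-eigenvalue `μ`: this is the classical computation of
`U_p` on `p`-old forms (Atkin–Lehner 1970, §2; Diamond–Shurman Prop. 5.6.2, second diagram) together
with `U_p g₀ = a_p(g₀) g₀` for a newform of level divisible by `p` (Atkin–Lehner–Li; the tree's
`IsNewform1.heckeT_apply_eq_cuspCoeff_smul`).  It is the form in which the passage "eigenform of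
weight `≥ 2` congruent to the `p`-stabilised weight-one form ⟹ `p`-ordinary newform" is used in the
classical (Deligne–Serre) treatment of ordinary lifts (Wiles, Invent. Math. 94 (1988), §1, p. 538).

**Proof** (assembled from the tree, as in `span_packetVectors_eq_top_aux` and
`exists_isNewform1_of_eigenpacket_prime_level`).  Call `b ∈ S_k(Γ₁(L))` a *`p`-packet vector* if it
carries the `T_q` (`q ∤ L`) and `⟨u⟩` eigenvalues of a newform `g₀` of some level `L₀ ∣ L` AND, when
`p ∣ L`, either `p ∣ L₀` and `U_p b = a_p(g₀) b`, or `p ∤ L₀` and `Q_{g₀}(U_p) b = 0`,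
`Q_{g₀} = X² - a_p(g₀) X + ε_{g₀}(p) p^{k-1}`.  (1) `span_pPacketVectors_eq_top_aux`: for `p² ∤ L`,
`S_k(Γ₁(L))` is spanned by `p`-packet vectors — strong induction on `L` through `old ⊕ new`
(`oldSubspace1_sup_newSubspace1_holds`), newforms spanning `new` (`span_newforms1_holds`) and the
rules `U_p [α_d] = [α_d] U_p` (`p ∣ L₁`, `p ∤ d`), `U_p [α_d] b = a_p [α_d] b - ε(p) [α_{dp}] b`,
`U_p [α_{dp}] b = p^{k-1} [α_d] b` (`p ∤ L₁ d`) of Diamond–Shurman Prop. 5.6.2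
(`heckeT_degeneracyMap1_of_not_dvd`, `…_of_dvd_of_not_dvd`, `…_mul`).  (2) The joint generalised
eigenspaces of `{T_q : q ∤ Np} ∪ {⟨u⟩}` are independent
(`Module.End.independent_iInf_maxGenEigenspace_of_forall_mapsTo`), so `g` lies in the span of the
`p`-packet vectors with ITS packet; the product of their polynomials (`X - a_p(g₀)` or `Q_{g₀}`) in
`U_p` kills `g`, and evaluating at the eigenvalue `μ` (`Module.End.aeval_apply_of_hasEigenvector`)
one factor vanishes at `μ`.

## References

* A. O. L. Atkin, J. Lehner, *Hecke operators on `Γ₀(m)`*, Math. Ann. 185 (1970), 134–160, §2.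
  [AtkinLehner1970]
* F. Diamond, J. Shurman, *A First Course in Modular Forms*, GTM 228 (2005), Prop. 5.6.2,
  Thm. 5.8.2, Thm. 5.8.3. [DiamondShurman2005]
* W.-C. W. Li, *Newforms and functional equations*, Math. Ann. 212 (1975), Thm. 3. [Li1975]
* A. Wiles, *On ordinary `λ`-adic representations associated to modular forms*, Invent. Math. 94
  (1988), 529–573, p. 538. [Wiles1988]
-/

noncomputable section

open scoped MatrixGroups ModularForm Polynomial

open CongruenceSubgroup Polynomial

namespace Literature.NumberTheory.EllipticCurves.ModularForms

/-! ### Linear algebra: the quadratic polynomial in an endomorphism -/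

section LinearAlgebra

variable {V : Type*} [AddCommGroup V] [Module ℂ V]

/-- `Q(U) x = U(U x) - α U x + β x` for `Q = X² - α X + β`. [folklore] -/
private theorem aeval_quadratic_apply' (U : Module.End ℂ V) (α β : ℂ) (x : V) :
    aeval U (X ^ 2 - C α * X + C β) x = U (U x) - α • U x + β • x := by
  simp only [map_add, map_sub, map_mul, aeval_X, aeval_C, LinearMap.add_apply,
    LinearMap.sub_apply, Module.End.mul_apply, Module.algebraMap_end_apply, pow_two]

/-- `(X - α)(U) x = U x - α x`. [folklore] -/
private theorem aeval_linear_apply' (U : Module.End ℂ V) (α : ℂ) (x : V) :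
    aeval U (X - C α) x = U x - α • x := by
  simp only [map_sub, aeval_X, aeval_C, LinearMap.sub_apply, Module.algebraMap_end_apply]

/-- Evaluation of `X² - α X + β`. [folklore] -/
private theorem eval_quadratic' (α β μ : ℂ) :
    (X ^ 2 - C α * X + C β : ℂ[X]).eval μ = μ ^ 2 - α * μ + β := by
  simp only [eval_add, eval_sub, eval_mul, eval_pow, eval_X, eval_C]

/-- If `U x = a x - c y` and `U y = t x` then `Q(U) x = 0` and `Q(U) y = 0` for
`Q = X² - a X + c t` (the characteristic polynomial of `(a, t; -c, 0)`). [folklore] -/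
private theorem aeval_quadratic_eq_zero_of_pair (U : Module.End ℂ V) {x y : V} {a c t : ℂ}
    (hx : U x = a • x - c • y) (hy : U y = t • x) :
    aeval U (X ^ 2 - C a * X + C (c * t)) x = 0 ∧ aeval U (X ^ 2 - C a * X + C (c * t)) y = 0 := by
  constructor
  · rw [aeval_quadratic_apply', hx, map_sub, map_smul, map_smul, hx, hy, smul_sub, smul_smul,
      smul_smul, smul_smul, mul_comm a c]
    abel
  · rw [aeval_quadratic_apply', hy, map_smul, hx, smul_sub, smul_smul, smul_smul, smul_smul,
      mul_comm _ a, mul_comm c t]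
    abel

end LinearAlgebra

/-! ### `p`-packet vectors span `S_k(Γ₁(L))` for `p² ∤ L` -/

section Span

variable (k : ℤ) {p : ℕ} [NeZero p]

set_option maxHeartbeats 800000 in
/-- **`S_k(Γ₁(L))` (`p² ∤ L`) is spanned by `p`-packet vectors**: simultaneous eigenvectors of the
`T_q` (`q ∤ L`) and the `⟨u⟩` carrying the packet of a newform `g₀` of some level `L₀ ∣ L` which,
when `p ∣ L`, are moreover `U_p`-eigenvectors with eigenvalue `a_p(g₀)` if `p ∣ L₀` and are killed
by `Q_{g₀}(U_p)`, `Q_{g₀} = X² - a_p(g₀)X + ε_{g₀}(p)p^{k-1}`, if `p ∤ L₀`.  Strong induction on the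
level (Diamond–Shurman, proof of Thm. 5.8.3, with Prop. 5.6.2 for `U_p` on the old forms).
[cite: DiamondShurman2005, Thm. 5.8.3 (proof) and Prop. 5.6.2] -/
theorem span_pPacketVectors_eq_top_aux (hp : p.Prime) :
    ∀ (L : ℕ) (hL : L ≠ 0), ¬ p ^ 2 ∣ L → haveI : NeZero L := ⟨hL⟩;
      Submodule.span ℂ {b : CuspForm (Gamma1 L) k |
        ∃ (L₀ : ℕ) (_ : NeZero L₀) (hL₀ : L₀ ∣ L) (g₀ : CuspForm (Gamma1 L₀) k), IsNewform1 g₀ ∧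
          (∀ (q : ℕ) (hq : q.Prime), ¬ q ∣ L →
            (haveI : NeZero q := ⟨hq.ne_zero⟩; heckeT (Gamma1 L) k q b) = cuspCoeff g₀ q • b) ∧
          (∀ u : (ZMod L)ˣ, diamondOp L k (u : ZMod L) b =
            DirichletCharacter.changeLevel hL₀ (nebentypus g₀) (u : ZMod L) • b) ∧
          (p ∣ L →
            (p ∣ L₀ ∧ heckeT (Gamma1 L) k p b = cuspCoeff g₀ p • b) ∨
            (¬ p ∣ L₀ ∧ aeval (heckeT (Gamma1 L) k p)
              (X ^ 2 - C (cuspCoeff g₀ p) * X +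
                C (nebentypus g₀ (p : ZMod L₀) * (p : ℂ) ^ (k - 1))) b = 0))} = ⊤ := by
  intro L
  induction L using Nat.strong_induction_on with
  | _ L ih =>
  intro hL hp2
  haveI : NeZero L := ⟨hL⟩
  apply top_unique
  rw [← oldSubspace1_sup_newSubspace1_holds L k, sup_le_iff]
  constructor
  · -- ### the old subspace: images `[α_d] b` of `p`-packet vectors `b` of the lower levels `L₁`
    rw [oldSubspace1, iSup_le_iff]
    rintro ⟨⟨L₁, d⟩, hL₁, hLd⟩
    haveI hL₁0 : NeZero L₁ := ⟨(Nat.pos_of_mem_properDivisors hL₁).ne'⟩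
    haveI : NeZero d := ⟨fun h ↦ NeZero.ne L (Nat.eq_zero_of_zero_dvd (by simpa [h] using hLd))⟩
    have hlt : L₁ < L := (Nat.mem_properDivisors.mp hL₁).2
    have hL₁L : L₁ ∣ L := (dvd_mul_right L₁ d).trans hLd
    have hp2' : ¬ p ^ 2 ∣ L₁ := fun h ↦ hp2 (h.trans hL₁L)
    have ih₁ := ih L₁ hlt hL₁0.out hp2'
    dsimp only at hLd ih₁ ⊢
    rw [LinearMap.range_eq_map, ← ih₁, Submodule.map_span, Submodule.span_le]
    rintro _ ⟨b, ⟨L₀, _, hL₀, g₀, hg₀, hbT, hbD, hbU⟩, rfl⟩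
    refine Submodule.subset_span ⟨L₀, inferInstance, hL₀.trans hL₁L, g₀, hg₀, ?_, ?_, ?_⟩
    · -- `T_q [α_d] = [α_d] T_q`, `q ∤ L`
      intro q hq hqL
      haveI : NeZero q := ⟨hq.ne_zero⟩
      have hqL₁ : ¬ q ∣ L₁ := fun h ↦ hqL (h.trans hL₁L)
      have hqd : ¬ q ∣ d := fun h ↦ hqL (h.trans ((dvd_mul_left d L₁).trans hLd))
      rw [heckeT_degeneracyMap1_of_not_dvd k hLd hq hqd ⟨fun h ↦ (hqL₁ h).elim, fun h ↦ (hqL h).elim⟩,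
        hbT q hq hqL₁, map_smul]
    · -- `⟨u⟩ [α_d] = [α_d] ⟨u mod L₁⟩`
      intro u
      rw [diamondOp_degeneracyMap1 L k hLd u.isUnit b]
      obtain ⟨u₁, hu₁⟩ := u.isUnit.map (ZMod.castHom hL₁L (ZMod L₁))
      rw [← hu₁, hbD u₁, map_smul, DirichletCharacter.changeLevel_trans _ hL₀ hL₁L,
        DirichletCharacter.changeLevel_eq_cast_of_dvd _ hL₁L u, hu₁, ZMod.castHom_apply]
    · -- `U_p` on `[α_d] b`
      intro hpL
      by_cases hpL₁ : p ∣ L₁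
      · -- `p ∣ L₁`: then `p ∤ d` and `U_p [α_d] = [α_d] U_p`
        have hpd : ¬ p ∣ d := by
          rintro ⟨e, rfl⟩
          obtain ⟨c, rfl⟩ := hpL₁
          exact hp2 ((Dvd.intro (c * e) (by ring)).trans hLd)
        have hcomm : ∀ v : CuspForm (Gamma1 L₁) k, heckeT (Gamma1 L) k p (degeneracyMap1 L₁ L d k v) =
            degeneracyMap1 L₁ L d k (heckeT (Gamma1 L₁) k p v) := fun v ↦
          heckeT_degeneracyMap1_of_not_dvd k hLd hp hpd ⟨fun _ ↦ hpL, fun _ ↦ hpL₁⟩ v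
        rcases hbU hpL₁ with ⟨hpL₀, hbU⟩ | ⟨hpL₀, hbU⟩
        · left
          exact ⟨hpL₀, by rw [hcomm, hbU, map_smul]⟩
        · right
          refine ⟨hpL₀, ?_⟩
          have h := congrArg (degeneracyMap1 L₁ L d k) hbU
          rw [map_zero, aeval_quadratic_apply', map_add, map_sub, map_smul, map_smul, ← hcomm,
            ← hcomm] at h
          rw [aeval_quadratic_apply']
          exact h
      · -- `p ∤ L₁` (so `p ∤ L₀`): `T_p b = a_p b`, `⟨p⟩ b = ε(p) b` at level `L₁`
        have hpL₀ : ¬ p ∣ L₀ := fun h ↦ hpL₁ (h.trans hL₀)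
        have hTb : heckeT (Gamma1 L₁) k p b = cuspCoeff g₀ p • b := hbT p hp hpL₁
        obtain ⟨up, hup⟩ := (ZMod.isUnit_prime_iff_not_dvd hp).mpr hpL₁
        have hcopZ : IsCoprime (p : ℤ) (L₁ : ℤ) :=
          Nat.isCoprime_iff_coprime.2 ((Nat.Prime.coprime_iff_not_dvd hp).2 hpL₁)
        have hε : DirichletCharacter.changeLevel hL₀ (nebentypus g₀) (p : ZMod L₁) =
            nebentypus g₀ (p : ZMod L₀) := by
          have h := DirichletCharacter.changeLevel_eq_cast_of_dvd' (nebentypus g₀) hL₀ hcopZ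
          simpa only [Int.cast_natCast] using h
        have hDb : diamondOp L₁ k (p : ZMod L₁) b = nebentypus g₀ (p : ZMod L₀) • b := by
          rw [← hε, ← hup, hbD up]
        right
        refine ⟨hpL₀, ?_⟩
        by_cases hpd : p ∣ d
        · -- `d = p e`, `p ∤ e`: `U_p [α_{pe}] b = p^{k-1} [α_e] b`, `U_p [α_e] b = a [α_e] b - ε [α_{ep}] b`
          obtain ⟨e, rfl⟩ := hpd
          haveI : NeZero e := ⟨fun h ↦ NeZero.ne (p * e) (by rw [h, mul_zero])⟩
          haveI : NeZero (e * p) := ⟨by rw [mul_comm]; exact NeZero.ne (p * e)⟩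
          have hpe : ¬ p ∣ e := by
            rintro ⟨c, rfl⟩
            exact hp2 ((Dvd.intro (L₁ * c) (by ring)).trans hLd)
          have hLe : L₁ * e ∣ L := (Dvd.intro p (by ring)).trans hLd
          have hLep : L₁ * (e * p) ∣ L := by rw [mul_comm e p]; exact hLd
          have hy : heckeT (Gamma1 L) k p (degeneracyMap1 L₁ L (p * e) k b) =
              ((p : ℂ) ^ (k - 1)) • degeneracyMap1 L₁ L e k b :=
            heckeT_degeneracyMap1_mul k hLd hLe hp hpL b
          have hx : heckeT (Gamma1 L) k p (degeneracyMap1 L₁ L e k b) =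
              cuspCoeff g₀ p • degeneracyMap1 L₁ L e k b -
                nebentypus g₀ (p : ZMod L₀) • degeneracyMap1 L₁ L (p * e) k b := by
            rw [heckeT_degeneracyMap1_of_dvd_of_not_dvd k hLe hLep hp hpL hpL₁ hpe b, hTb, hDb,
              map_smul, map_smul, degeneracyMap1_congr_index (mul_comm e p) b]
          exact (aeval_quadratic_eq_zero_of_pair _ hx hy).2
        · -- `p ∤ d`: `U_p [α_d] b = a [α_d] b - ε [α_{dp}] b`, `U_p [α_{dp}] b = p^{k-1} [α_d] b`
          haveI : NeZero (d * p) := ⟨mul_ne_zero (NeZero.ne d) hp.ne_zero⟩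
          haveI : NeZero (p * d) := ⟨mul_ne_zero hp.ne_zero (NeZero.ne d)⟩
          have hcop : Nat.Coprime p (L₁ * d) :=
            (Nat.Prime.coprime_iff_not_dvd hp).2 fun h ↦ (hp.dvd_mul.mp h).elim hpL₁ hpd
          have hLdp : L₁ * (d * p) ∣ L := by
            rw [← mul_assoc]
            exact Nat.Coprime.mul_dvd_of_dvd_of_dvd hcop.symm hLd hpL
          have hLpd : L₁ * (p * d) ∣ L := by rw [mul_comm p d]; exact hLdp
          have hx : heckeT (Gamma1 L) k p (degeneracyMap1 L₁ L d k b) =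
              cuspCoeff g₀ p • degeneracyMap1 L₁ L d k b -
                nebentypus g₀ (p : ZMod L₀) • degeneracyMap1 L₁ L (p * d) k b := by
            rw [heckeT_degeneracyMap1_of_dvd_of_not_dvd k hLd hLdp hp hpL hpL₁ hpd b, hTb, hDb,
              map_smul, map_smul, degeneracyMap1_congr_index (mul_comm d p) b]
          have hy : heckeT (Gamma1 L) k p (degeneracyMap1 L₁ L (p * d) k b) =
              ((p : ℂ) ^ (k - 1)) • degeneracyMap1 L₁ L d k b :=
            heckeT_degeneracyMap1_mul k hLpd hLd hp hpL b
          exact (aeval_quadratic_eq_zero_of_pair _ hx hy).1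
  · -- ### the new subspace: spanned by newforms, which are `p`-packet vectors for themselves
    rw [← span_newforms1_holds L k, Submodule.span_le]
    intro g₀ hg₀
    refine Submodule.subset_span ⟨L, inferInstance, dvd_rfl, g₀, hg₀, fun q hq _ ↦ ?_, fun u ↦ ?_,
      fun hpL ↦ Or.inl ⟨hpL, hg₀.heckeT_apply_eq_cuspCoeff_smul p hp⟩⟩
    · haveI : NeZero q := ⟨hq.ne_zero⟩
      exact hg₀.heckeT_apply_eq_cuspCoeff_smul q hq
    · rw [DirichletCharacter.changeLevel_self]
      exact (mem_nebentypusSubspace_iff_diamondOp.mp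
        (IsNewform1.mem_nebentypusSubspace_nebentypus_holds hg₀)) u

end Span

/-! ### The theorem -/

section Main

variable {N p : ℕ} [NeZero N] [NeZero p] {k : ℤ}

set_option maxHeartbeats 800000 in
/-- **The newform behind an eigenform of the `T_q` (`q ∤ Np`) and of `U_p` in `S_k(Np, χ)`,
`p ∤ N` prime, `χ` arbitrary.**  Let `g ∈ S_k(Γ₁(Np))`, `g ≠ 0`, with `⟨u⟩ g = χ(u) g`,
`T_q g = a_q g` for every prime `q ∤ Np` and `U_p g = μ g`.  Then there are `L₀ ∣ Np` and a
newform `g₀ ∈ S_k(Γ₁(L₀))` with `a_q(g₀) = a_q` for all primes `q ∤ Np`, whose nebentypus induces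
`χ`, and EITHER `p ∣ L₀` and `a_p(g₀) = μ`, OR `p ∤ L₀` and `μ² - a_p(g₀) μ + ε_{g₀}(p) p^{k-1} = 0`
(Atkin–Lehner 1970, §2; Diamond–Shurman Prop. 5.6.2 and Thms. 5.8.2–5.8.3; the version of
`exists_isNewform1_of_eigenpacket_prime_level` without the primitivity of the character).
[cite: DiamondShurman2005, Prop. 5.6.2, Thm. 5.8.2, Thm. 5.8.3] [cite: AtkinLehner1970, §2] -/
theorem exists_isNewform1_of_eigenpacket_of_heckeT_prime (hp : p.Prime) (hpN : ¬ p ∣ N)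
    {g : CuspForm (Gamma1 (N * p)) k} (hg0 : g ≠ 0)
    {χ : DirichletCharacter ℂ (N * p)} (hgχ : g ∈ nebentypusSubspace (N * p) k χ)
    {a : ℕ → ℂ}
    (hT : ∀ (q : ℕ) (hq : q.Prime), ¬ q ∣ N * p →
      (haveI : NeZero q := ⟨hq.ne_zero⟩; heckeT (Gamma1 (N * p)) k q g) = a q • g)
    {μ : ℂ} (hU : heckeT (Gamma1 (N * p)) k p g = μ • g) :
    ∃ (L₀ : ℕ) (_ : NeZero L₀) (hL₀ : L₀ ∣ N * p) (g₀ : CuspForm (Gamma1 L₀) k), IsNewform1 g₀ ∧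
      (∀ q : ℕ, q.Prime → ¬ q ∣ N * p → cuspCoeff g₀ q = a q) ∧
      DirichletCharacter.changeLevel hL₀ (nebentypus g₀) = χ ∧
      ((p ∣ L₀ ∧ cuspCoeff g₀ p = μ) ∨
        (¬ p ∣ L₀ ∧ μ ^ 2 - cuspCoeff g₀ p * μ + nebentypus g₀ (p : ZMod L₀) * (p : ℂ) ^ (k - 1) = 0)) := by
  classical
  have hpL : p ∣ N * p := dvd_mul_left p N
  have hp2 : ¬ p ^ 2 ∣ N * p := by
    rw [pow_two]
    intro h
    exact hpN (Nat.dvd_of_mul_dvd_mul_right hp.pos h)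
  -- diamonds on `g`
  have hgD : ∀ u : (ZMod (N * p))ˣ, diamondOp (N * p) k (u : ZMod (N * p)) g = χ u • g :=
    mem_nebentypusSubspace_iff_diamondOp.mp hgχ
  -- ### the commuting family `{T_q : q ∤ Np} ∪ {⟨u⟩}` and its joint generalised eigenspaces
  let I : Type := {q : ℕ // q.Prime ∧ ¬ q ∣ N * p} ⊕ (ZMod (N * p))ˣ
  let F : I → Module.End ℂ (CuspForm (Gamma1 (N * p)) k) :=
    Sum.elim (fun q ↦ haveI : NeZero q.1 := ⟨q.2.1.ne_zero⟩; heckeT (Gamma1 (N * p)) k q.1)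
      (fun u ↦ diamondOp (N * p) k (u : ZMod (N * p)))
  have hcomm : ∀ i j : I, Commute (F i) (F j) := by
    rintro (⟨q, hq, hqM⟩ | u) (⟨q', hq', hqM'⟩ | v)
    · haveI : NeZero q := ⟨hq.ne_zero⟩
      haveI : NeZero q' := ⟨hq'.ne_zero⟩
      exact heckeT_comm_holds (N * p) k q q'
    · haveI : NeZero q := ⟨hq.ne_zero⟩
      exact heckeT_diamondOp_comm_holds (N := N * p) (k := k) q (v : ZMod (N * p))
    · haveI : NeZero q' := ⟨hq'.ne_zero⟩
      exact (heckeT_diamondOp_comm_holds (N := N * p) (k := k) q' (u : ZMod (N * p))).symm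
    · exact diamondOp_comm (N * p) k _ _
  let V : (I → ℂ) → Submodule ℂ (CuspForm (Gamma1 (N * p)) k) :=
    fun θ ↦ ⨅ i, (F i).maxGenEigenspace (θ i)
  have hind : iSupIndep V :=
    Module.End.independent_iInf_maxGenEigenspace_of_forall_mapsTo F fun i j φ ↦
      Module.End.mapsTo_maxGenEigenspace_of_comm (hcomm j i) φ
  let pk : (ℕ → ℂ) → DirichletCharacter ℂ (N * p) → I → ℂ :=
    fun a' χ' ↦ Sum.elim (fun q ↦ a' q.1) (fun u ↦ χ' (u : ZMod (N * p)))
  have hmemV : ∀ {b : CuspForm (Gamma1 (N * p)) k} {a' : ℕ → ℂ}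
      {χ' : DirichletCharacter ℂ (N * p)},
      (∀ (q : ℕ) (hq : q.Prime), ¬ q ∣ N * p →
        (haveI : NeZero q := ⟨hq.ne_zero⟩; heckeT (Gamma1 (N * p)) k q b) = a' q • b) →
      (∀ u : (ZMod (N * p))ˣ, diamondOp (N * p) k (u : ZMod (N * p)) b = χ' u • b) →
      b ∈ V (pk a' χ') := by
    intro b a' χ' hT' hD'
    change b ∈ ⨅ i, (F i).maxGenEigenspace (pk a' χ' i)
    rw [Submodule.mem_iInf]
    rintro (⟨q, hq, hqM⟩ | u)
    · exact Module.End.eigenspace_le_maxGenEigenspace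
        (Module.End.mem_eigenspace_iff.mpr (hT' q hq hqM))
    · exact Module.End.eigenspace_le_maxGenEigenspace
        (Module.End.mem_eigenspace_iff.mpr (hD' u))
  set θ₀ : I → ℂ := pk a χ with hθ₀
  have hgV : g ∈ V θ₀ := hmemV hT hgD
  -- ### the `θ₀`-sources: `p`-packet vectors with the packet of `g`
  set U := heckeT (Gamma1 (N * p)) k p with hUdef
  let S₀ : Set (CuspForm (Gamma1 (N * p)) k) :=
    {x | ∃ (L₀ : ℕ) (_ : NeZero L₀) (hL₀ : L₀ ∣ N * p) (g₀ : CuspForm (Gamma1 L₀) k),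
      IsNewform1 g₀ ∧
      (∀ (q : ℕ) (hq : q.Prime), ¬ q ∣ N * p →
        (haveI : NeZero q := ⟨hq.ne_zero⟩; heckeT (Gamma1 (N * p)) k q x) = cuspCoeff g₀ q • x) ∧
      (∀ u : (ZMod (N * p))ˣ, diamondOp (N * p) k (u : ZMod (N * p)) x =
        DirichletCharacter.changeLevel hL₀ (nebentypus g₀) (u : ZMod (N * p)) • x) ∧
      (∀ q : ℕ, q.Prime → ¬ q ∣ N * p → cuspCoeff g₀ q = a q) ∧
      DirichletCharacter.changeLevel hL₀ (nebentypus g₀) = χ ∧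
      ((p ∣ L₀ ∧ U x = cuspCoeff g₀ p • x) ∨
        (¬ p ∣ L₀ ∧ aeval U (X ^ 2 - C (cuspCoeff g₀ p) * X +
          C (nebentypus g₀ (p : ZMod L₀) * (p : ℂ) ^ (k - 1))) x = 0))}
  -- the other packets
  let W' : Submodule ℂ (CuspForm (Gamma1 (N * p)) k) := ⨆ θ ∈ {θ : I → ℂ | θ ≠ θ₀}, V θ
  -- ### Claim A: everything lies in `span S₀ ⊔ W'`
  have hA : (⊤ : Submodule ℂ (CuspForm (Gamma1 (N * p)) k)) ≤ Submodule.span ℂ S₀ ⊔ W' := by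
    rw [← span_pPacketVectors_eq_top_aux k hp (N * p) (NeZero.ne (N * p)) hp2, Submodule.span_le]
    rintro x ⟨L₀, _, hL₀, g₀, hg₀, hxT, hxD, hxU⟩
    set θ : I → ℂ := pk (cuspCoeff g₀) (DirichletCharacter.changeLevel hL₀ (nebentypus g₀)) with hθdef
    have hxV : x ∈ V θ := hmemV hxT hxD
    by_cases hθ : θ = θ₀
    · refine Submodule.mem_sup_left (Submodule.subset_span ?_)
      have hq0 : ∀ q : ℕ, q.Prime → ¬ q ∣ N * p → cuspCoeff g₀ q = a q := by
        intro q hq hqL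
        have h := congrFun hθ (.inl ⟨q, hq, hqL⟩)
        simpa only [hθdef, hθ₀, pk, Sum.elim_inl] using h
      have hneb : DirichletCharacter.changeLevel hL₀ (nebentypus g₀) = χ := by
        refine MulChar.ext fun u ↦ ?_
        have h := congrFun hθ (.inr u)
        simpa only [hθdef, hθ₀, pk, Sum.elim_inr] using h
      exact ⟨L₀, inferInstance, hL₀, g₀, hg₀, hxT, hxD, hq0, hneb, hxU hpL⟩
    · exact Submodule.mem_sup_right
        (Submodule.mem_iSup_of_mem θ (Submodule.mem_iSup_of_mem (show θ ∈ {θ | θ ≠ θ₀} from hθ) hxV))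
  -- ### Claim B: `g ∈ span S₀`
  have hS₀V : Submodule.span ℂ S₀ ≤ V θ₀ := by
    rw [Submodule.span_le]
    rintro x ⟨L₀, _, hL₀, g₀, -, hxT, hxD, hq0, hneb, -⟩
    refine hmemV (fun q hq hqL ↦ ?_) (fun u ↦ ?_)
    · rw [hxT q hq hqL, hq0 q hq hqL]
    · rw [hxD u, hneb]
  have hgS : g ∈ Submodule.span ℂ S₀ := by
    obtain ⟨s, hs, w, hw, hsw⟩ := Submodule.mem_sup.mp (hA (Submodule.mem_top (x := g)))
    have hwV : w ∈ V θ₀ := by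
      have : w = g - s := eq_sub_of_add_eq' hsw
      rw [this]
      exact (V θ₀).sub_mem hgV (hS₀V hs)
    have hdis : Disjoint (V θ₀) W' :=
      hind.disjoint_biSup (show θ₀ ∉ {θ : I → ℂ | θ ≠ θ₀} from fun h ↦ h rfl)
    have hw0 : w = 0 := (Submodule.disjoint_def.mp hdis) w hwV hw
    rw [hw0, add_zero] at hsw
    rw [← hsw]
    exact hs
  -- ### Claim C: a finite spanning family of sources and the product of their polynomials in `U_p`
  obtain ⟨T, hTS, hgT⟩ := Submodule.mem_span_finite_of_mem_span hgS
  have hdat : ∀ x : CuspForm (Gamma1 (N * p)) k, x ∈ (T : Set _) →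
      ∃ P : ℂ[X], aeval U P x = 0 ∧ (P.eval μ = 0 →
        ∃ (L₀ : ℕ) (_ : NeZero L₀) (hL₀ : L₀ ∣ N * p) (g₀ : CuspForm (Gamma1 L₀) k), IsNewform1 g₀ ∧
          (∀ q : ℕ, q.Prime → ¬ q ∣ N * p → cuspCoeff g₀ q = a q) ∧
          DirichletCharacter.changeLevel hL₀ (nebentypus g₀) = χ ∧
          ((p ∣ L₀ ∧ cuspCoeff g₀ p = μ) ∨
            (¬ p ∣ L₀ ∧ μ ^ 2 - cuspCoeff g₀ p * μ +
              nebentypus g₀ (p : ZMod L₀) * (p : ℂ) ^ (k - 1) = 0))) := by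
    intro x hx
    obtain ⟨L₀, _, hL₀, g₀, hg₀, -, -, hq0, hneb, hxU⟩ := hTS hx
    rcases hxU with ⟨hpL₀, hxU⟩ | ⟨hpL₀, hxU⟩
    · refine ⟨X - C (cuspCoeff g₀ p), ?_, fun hev ↦ ?_⟩
      · rw [aeval_linear_apply', hxU, sub_self]
      · rw [eval_sub, eval_X, eval_C, sub_eq_zero] at hev
        exact ⟨L₀, inferInstance, hL₀, g₀, hg₀, hq0, hneb, Or.inl ⟨hpL₀, hev.symm⟩⟩
    · refine ⟨_, hxU, fun hev ↦ ?_⟩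
      rw [eval_quadratic'] at hev
      exact ⟨L₀, inferInstance, hL₀, g₀, hg₀, hq0, hneb, Or.inr ⟨hpL₀, hev⟩⟩
  choose! P hP hP' using hdat
  set Ptot : ℂ[X] := ∏ x ∈ T, P x with hPtot
  have hPx : ∀ x ∈ T, aeval U Ptot x = 0 := by
    intro x hx
    rw [hPtot, ← Finset.prod_erase_mul _ _ hx, map_mul, Module.End.mul_apply]
    change aeval U (∏ x ∈ T.erase x, P x) (aeval U (P x) x) = 0
    rw [hP x hx, map_zero]
  have hPg : aeval U Ptot g = 0 := by
    obtain ⟨c, -, hc⟩ := Submodule.mem_span_finset.mp hgT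
    rw [← hc, map_sum]
    refine Finset.sum_eq_zero fun x hx ↦ ?_
    rw [map_smul, hPx x hx, smul_zero]
  -- ### evaluating at the eigenvalue `μ`
  have heig : Module.End.HasEigenvector U μ g := ⟨Module.End.mem_eigenspace_iff.mpr hU, hg0⟩
  have hPμ : Ptot.eval μ = 0 := by
    have h := Module.End.aeval_apply_of_hasEigenvector (p := Ptot) heig
    rw [hPg] at h
    exact (smul_eq_zero.mp h.symm).resolve_right hg0
  rw [hPtot, eval_prod, Finset.prod_eq_zero_iff] at hPμ
  obtain ⟨x, hx, hxμ⟩ := hPμ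
  exact hP' x hx hxμ

end Main

end Literature.NumberTheory.EllipticCurves.ModularForms

end
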